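import Summits.HodgeConjecture.HodgeConjecture.Theorems.F0P2eStubLRLocalReindex                 -- ★ p808692: `nonempty_equiv_rhoAtLine_chi_reindex`, `rhoAtLine_chi_id_isIrreducible` (pulls ★ `F0P2cStubCI`)
import Literature.NumberTheory.Automorphic.Liu2021.LemD1Item3AtVNonsplitOfLineTransport            -- ★ `sameClass_and_chi_eq_of_areIsomorphicRep_nonsplit_prodUnique` (non-split ε-clause, mod IV-4c1)
import Literature.NumberTheory.Automorphic.Liu2021.LemD1AsPrintedIndexedNonVacuityNonsplitPlace     -- ★ `sameClass_of_split` (split ε-clause, hypothesis-free)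
import Literature.NumberTheory.Automorphic.Liu2021.LemD1SplitPlaceOfFacts                            -- ★ `exists_placesOver_smul_ne_of_not_isField`
import Literature.NumberTheory.Automorphic.Liu2021.Def411WeilCarriersTripleSeparation                -- ★ `locF_eq_of_forall_sameClass_epsLine` (globalised ε-leg)
import Literature.NumberTheory.Automorphic.Liu2021.Def411WeilCarriersLocalTypesOfEquiv               -- ★ `nonempty_equiv_localTypes_of_equiv` (restriction step)
import Literature.NumberTheory.Automorphic.Liu2021.Def411WeilCarriersLocalDataAtV                    -- ★ `quotEquivLocalType`
import Literature.NumberTheory.Automorphic.Liu2021.LemD1LocalInjectivity                             -- ★ `areIsomorphicRep_of_equiv`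
import Literature.RepresentationTheory.MoeglinVignerasWaldspurger1987.RankOneThetaLiftLinesDisjointHolds  -- ★ row IV-4c1 `rankOne_theta_lines_disjoint_holds`
import HarnessLib

/-!
# FLOOR-0 P2 — E3♭∞ RUNG 3, row «RIG-ε»: ε-rigidity of equivalent theta carriers at a fixed `μ` (in-house; theorems only)

Cell hodgecm-mathlib (D-0151), FLOOR 0, programme P2 (theta ∕ `hdictE`); crux item H413 = stmt-HodgeConjecture-24833 (`HCCMUnconditional.H413`).
Sub-line of record `Cruxes/H413/Lines/F0_P2E3Rung3.lean` v1 (F0P2-plan (g7), sha16 809baa7acc4bedcc), registered stub `stub_thetaCarrier_epsRigidity :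
StubThetaCarrierEpsRigidity` (:571); row dealt to seat F0P2-p02 (g4) (P2 bus 11:58:20Z).  THEOREMS ONLY (no `def`, no instance, no notation, no named
fact, no `sorry`); never imports a `Cruxes/…/Lines` module (O50-1); the statement below RESTATES the body of `StubThetaCarrierEpsRigidity` (:480–536)
token for token; `--supports stmt-HodgeConjecture-24833 --as helper`.  HC_CM is proved only modulo the printed citations until rung 0 closes; this file
discharges none of them.

MATHEMATICS (all inputs ★; an ADAPTER in the sense of the card: [Liu2021, App. D Lem. D.1 (3)]'s `ε`-leg for the CM family, letter-free today).
Let `ω_H(μ, a, χ)` and `ω_H(μ, a′, χ′)` (theta carriers of `U(H)(𝔸_{L⁺,f})` along the frame transport `ιV`, enumeration `e₁`) be equivalent.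
(0) ENUMERATION: ★ `F0P2eStubLRLocalReindex.nonempty_equiv_rhoAtLine_chi_reindex` moves both carriers to `e := Equiv.prodUnique (Fin 3) (Fin 1)`, the
enumeration at which fan A's HD3 rows are typed. (1) RESTRICTION [Flath1979, Thm. 3 uniqueness]: `ιV` is onto (★ `F0P2cStubCI.surjective_of_pinned`), the carrier
is irreducible hence non-zero (★ `rhoAtLine_chi_id_isIrreducible`), and [Lem. D.1 (1)] holds per place (★ `F0P2cStubCI.lemD1_1AsPrinted_chi`) — so ★
`nonempty_equiv_localTypes_of_equiv` gives `X_v(μ, a, χ) ≃ X_v(μ, a′, χ′)` at every finite `v`. (2) PER PLACE, the `ε`-clause of [Lem. D.1 (3)]: at a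
NON-SPLIT `v` the local theta DICHOTOMY ★ `sameClass_and_chi_eq_of_areIsomorphicRep_nonsplit_prodUnique` (over ★ row IV-4c1
`rankOne_theta_lines_disjoint_holds`; [GelbartRogawski1991, Lem. 5.1.2, Prop. 5.2.2]; [MoeglinVignerasWaldspurger1987, Ch. 3 IV.4]) puts the Step-1
representatives of `⟨a⟩`, `⟨a′⟩` in one `Nm(L_v^×)`-class; at a SPLIT `v` there is only one class (★ `sameClass_of_split`). (3) GLOBALISATION: ★
`locF_eq_of_forall_sameClass_epsLine` — the collections `(a·Nm)_v`, `(a′·Nm)_v` coincide: `locF a′ = locF a`.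

* §1 `nontrivial_omegaAtLine_rank3` — the shared non-vanishing brick (desk 12:04:49Z (b)); §2 `stubRIGeps_holds` — the registered text.

## References
* [Liu2021] Y. Liu, Camb. J. Math. 9 (2021) = arXiv:2102.11518: Def. 4.11–4.12 (l. 2083–2108), App. D Lem. D.1 (1), (3) (l. 5229–5233), §D.1 Step 1 (l. 5217).
* [GelbartRogawski1991] S. Gelbart, J. Rogawski, Invent. Math. 105 (1991): Lem. 5.1.2, Prop. 5.2.2.  [Rogawski1990] Ann. of Math. Stud. 123: §12.2.
* [MoeglinVignerasWaldspurger1987] C. Mœglin, M.-F. Vignéras, J.-L. Waldspurger, LNM 1291: Chap. 3 IV.2, IV.4.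
* [FlathCorvallis1979] D. Flath, PSPM 33.1 (1979): Theorem 3 (uniqueness clause).  [HarrisKudlaSweet1996] J. AMS 9: Thm. 6.1.
-/

set_option autoImplicit false
-- the mandated namespace has the single-problem summit's repeated segment (`HodgeConjecture.HodgeConjecture`)
set_option linter.dupNamespace false

noncomputable section

open NumberField IsDedekindDomain MeasureTheory
open scoped Matrix ComplexOrder

namespace Summit.HodgeConjecture.HodgeConjecture.Cruxes.H413.F0P2mStubRIGeps

open Literature.NumberTheory Literature.NumberTheory.Automorphic Literature.NumberTheory.Automorphic.UnitaryGroup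
open Literature.NumberTheory.Automorphic.IdeleClassGroup
open Literature.NumberTheory.Automorphic.Liu2021 Literature.NumberTheory.Automorphic.Liu2021.Def411WeilCarriers
open Literature.NumberTheory.Automorphic.Liu2021.Def411WeilCarriersDoubling
open Literature.NumberTheory.GelbartRogawski1991 Literature.NumberTheory.GelbartRogawski1991.UnitaryDualPair
open Literature.NumberTheory.GelbartRogawski1991.UnitaryDualPair.WeilCoinv
open Literature.NumberTheory.GelbartRogawski1991.UnitaryDualPair.LocalSplitting (localMu norm_localMu continuous_localMu localMu_toLocalRing_eq_one_iff)
open Literature.RepresentationTheory Literature.RepresentationTheory.Liu2021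
open Literature.RepresentationTheory.MoeglinVignerasWaldspurger1987 (rankOne_theta_lines_disjoint_holds)
open Literature.NumberTheory.GaloisRepresentations
open Summit.HodgeConjecture.CorCM.Transposition
open Summit.HodgeConjecture.HodgeConjecture.Cruxes.H413.F0P2cStubCI (surjective_of_pinned lemD1_1AsPrinted_chi)
open Summit.HodgeConjecture.HodgeConjecture.Cruxes.H413.F0P2eStubLRLocalReindex (nonempty_equiv_rhoAtLine_chi_reindex rhoAtLine_chi_id_isIrreducible)

set_option synthInstance.maxHeartbeats 400000 in
set_option maxHeartbeats 8000000 in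
/-- **Shared brick (desk 12:04:49Z (b)): the theta carrier `ω_H(μ, a, χ)` of rank `3` is NON-ZERO** — for every CM frame `dV`, every enumeration
`e₁`, every conjugate-symplectic `μ`, line `a` and `χ ∈ Chi`: the carrier `omegaAtLine … (Matrix.diagonal dV) … a χ` is `Nontrivial`, because on
`U(diag dV)(𝔸_{L⁺,f})` itself it is IRREDUCIBLE (★ `F0P2eStubLRLocalReindex.rhoAtLine_chi_id_isIrreducible`, from [Liu2021, Lem. D.1 (1)] per place ★
`F0P2cStubCI.lemD1_1AsPrinted_chi`).  The `hnt` input of ★ `nonempty_equiv_localTypes_of_equiv` ∕ `forall_localMu_eq_of_equiv_of_…` for RIG-ε, RIG-μ, conj.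
[cite: Liu2021, Def. 4.11 (l. 2090–2096), App. D Lem. D.1 (1) (l. 5229)] [cite: GelbartRogawski1991, §3.1 Prop. 3.1.1] -/
theorem nontrivial_omegaAtLine_rank3 (L : Type) [Field L] [NumberField L] [IsCMField L] {n' : ℕ} (e₁ : Fin 3 × Fin 1 ≃ Fin n')
    (dV : Fin 3 → L) (hdV : ∀ i, IsCMField.complexConj L (dV i) = dV i) (hdV0 : ∀ i, dV i ≠ 0)
    (μ : Literature.NumberTheory.Automorphic.IdeleClassGroup L →ₜ* Circle) (hμ : IsConjugateSymplectic L μ)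
    (a : (↥(maximalRealSubfield L))ˣ) (χ : Chi (↥(maximalRealSubfield L)) L (IsCMField.complexConj L)) :
    Nontrivial
      (omegaAtLine (↥(maximalRealSubfield L)) L (IsCMField.complexConj L) 3 e₁ (Matrix.diagonal dV) (complexConj_imagUnit L)
        (imagUnit_ne_zero L) (imagUnit_mul_self L) (realDiagonal_isSymm L dV hdV) (isUnit_det_realDiagonal L dV hdV hdV0)
        (realDiagonal_map L dV hdV).symm
        (fun a => isCompatible_chiSplittingLine L e₁ dV hdV hdV0 (toHeckeCharacter L μ) (isUnitary_toHeckeCharacter L μ)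
          ((isOscillatorChar_toHeckeCharacter_iff μ).mpr hμ) (TW (↥(maximalRealSubfield L)) a)
          (isSymm_TW (↥(maximalRealSubfield L)) a) (isUnit_det_TW (↥(maximalRealSubfield L)) a)
          (JW (↥(maximalRealSubfield L)) L a) (JW_eq (↥(maximalRealSubfield L)) L a)) a χ) := by
  haveI := rhoAtLine_chi_id_isIrreducible L dV hdV hdV0 μ hμ a χ e₁
  exact Representation.IsIrreducible.nontrivial
    (rhoAtLine (↥(maximalRealSubfield L)) L (IsCMField.complexConj L) 3 e₁ (Matrix.diagonal dV)
        (complexConj_imagUnit L) (imagUnit_ne_zero L) (imagUnit_mul_self L) (realDiagonal_isSymm L dV hdV) (isUnit_det_realDiagonal L dV hdV hdV0)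
        (realDiagonal_map L dV hdV).symm
        (fun a => isCompatible_chiSplittingLine L e₁ dV hdV hdV0 (toHeckeCharacter L μ)
          (isUnitary_toHeckeCharacter L μ) ((isOscillatorChar_toHeckeCharacter_iff μ).mpr hμ) (TW (↥(maximalRealSubfield L)) a)
          (isSymm_TW (↥(maximalRealSubfield L)) a) (isUnit_det_TW (↥(maximalRealSubfield L)) a)
          (JW (↥(maximalRealSubfield L)) L a) (JW_eq (↥(maximalRealSubfield L)) L a))
        (MonoidHom.id (finAdelic (↥(maximalRealSubfield L)) L (IsCMField.complexConj L) 3 (Matrix.diagonal dV))) a χ)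

set_option synthInstance.maxHeartbeats 400000 in
set_option maxHeartbeats 16000000 in
/-- **RIG-ε — ε-RIGIDITY OF EQUIVALENT THETA CARRIERS AT A FIXED `μ`** (the body of `F0P2E3Rung3.StubThetaCarrierEpsRigidity` VERBATIM): if
`ω_H(μ, a, χ)` and `ω_H(μ, a′, χ′)` are `U(H)(𝔸_{L⁺,f})`-equivalent then `locF a′ = locF a`.  Proof: enumeration transport to `Equiv.prodUnique`, the
restriction step (Flath), the per-place `ε`-clause of [Liu2021, Lem. D.1 (3)] (non-split: theta dichotomy over ★ IV-4c1; split: one class), globalisation.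
[cite: Liu2021, App. D Lem. D.1 (3), §D.1 Step 1 (l. 5217)] [cite: GelbartRogawski1991, Lem. 5.1.2, Prop. 5.2.2] [cite: MoeglinVignerasWaldspurger1987, Chap. 3 IV.4]
[cite: FlathCorvallis1979, Theorem 3] -/
theorem stubRIGeps_holds :
  ∀ (L : Type) [Field L] [NumberField L] [IsCMField L] (H : Matrix (Fin 3) (Fin 3) L),
    ∀ {n' : ℕ} (e₁ : Fin 3 × Fin 1 ≃ Fin n') (dV : Fin 3 → L) (hdV : ∀ i, IsCMField.complexConj L (dV i) = dV i)
      (hdV0 : ∀ i, dV i ≠ 0) (g : GL (Fin 3) L)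
      (hg : ((g : Matrix (Fin 3) (Fin 3) L).map (cmConjRingHom L))ᵀ * H * (g : Matrix (Fin 3) (Fin 3) L) = Matrix.diagonal dV)
      (ιV : finAdelic (↥(maximalRealSubfield L)) L (IsCMField.complexConj L) 3 H →*
          finAdelic (↥(maximalRealSubfield L)) L (IsCMField.complexConj L) 3 (Matrix.diagonal dV)),
        (∀ k, ((ιV k : finAdelic (↥(maximalRealSubfield L)) L (IsCMField.complexConj L) 3 (Matrix.diagonal dV)) :
            GL (Fin 3) (FiniteAdeleRing (𝓞 L) L)) =
          (toFinAdeleGL L 3 g)⁻¹ * (k : GL (Fin 3) (FiniteAdeleRing (𝓞 L) L)) * toFinAdeleGL L 3 g) →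
        ∀ (μ : Literature.NumberTheory.Automorphic.IdeleClassGroup L →ₜ* Circle) (hμ : IsConjugateSymplectic L μ) (a : (↥(maximalRealSubfield L))ˣ) (χ : Chi (↥(maximalRealSubfield L)) L (IsCMField.complexConj L))
          (a' : (↥(maximalRealSubfield L))ˣ) (χ' : Chi (↥(maximalRealSubfield L)) L (IsCMField.complexConj L)),
          (
              ∃ f :
                  (omegaAtLine (↥(maximalRealSubfield L)) L (IsCMField.complexConj L) 3 e₁ (Matrix.diagonal dV)
                    (complexConj_imagUnit L) (imagUnit_ne_zero L) (imagUnit_mul_self L) (realDiagonal_isSymm L dV hdV)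
                    (isUnit_det_realDiagonal L dV hdV hdV0) (realDiagonal_map L dV hdV).symm
                    (fun a => isCompatible_chiSplittingLine L e₁ dV hdV hdV0 (toHeckeCharacter L μ)
                      (isUnitary_toHeckeCharacter L μ) ((isOscillatorChar_toHeckeCharacter_iff μ).mpr hμ)
                      (TW (↥(maximalRealSubfield L)) a) (isSymm_TW (↥(maximalRealSubfield L)) a)
                      (isUnit_det_TW (↥(maximalRealSubfield L)) a) (JW (↥(maximalRealSubfield L)) L a)
                      (JW_eq (↥(maximalRealSubfield L)) L a)) a χ) ≃ₗ[ℂ]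
                  (omegaAtLine (↥(maximalRealSubfield L)) L (IsCMField.complexConj L) 3 e₁ (Matrix.diagonal dV)
                    (complexConj_imagUnit L) (imagUnit_ne_zero L) (imagUnit_mul_self L) (realDiagonal_isSymm L dV hdV)
                    (isUnit_det_realDiagonal L dV hdV hdV0) (realDiagonal_map L dV hdV).symm
                    (fun a => isCompatible_chiSplittingLine L e₁ dV hdV hdV0 (toHeckeCharacter L μ)
                      (isUnitary_toHeckeCharacter L μ) ((isOscillatorChar_toHeckeCharacter_iff μ).mpr hμ)
                      (TW (↥(maximalRealSubfield L)) a) (isSymm_TW (↥(maximalRealSubfield L)) a)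
                      (isUnit_det_TW (↥(maximalRealSubfield L)) a) (JW (↥(maximalRealSubfield L)) L a)
                      (JW_eq (↥(maximalRealSubfield L)) L a)) a' χ'),
                ∀ (k : finAdelic (↥(maximalRealSubfield L)) L (IsCMField.complexConj L) 3 H)
                  (x :
                  (omegaAtLine (↥(maximalRealSubfield L)) L (IsCMField.complexConj L) 3 e₁ (Matrix.diagonal dV)
                    (complexConj_imagUnit L) (imagUnit_ne_zero L) (imagUnit_mul_self L) (realDiagonal_isSymm L dV hdV)
                    (isUnit_det_realDiagonal L dV hdV hdV0) (realDiagonal_map L dV hdV).symm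
                    (fun a => isCompatible_chiSplittingLine L e₁ dV hdV hdV0 (toHeckeCharacter L μ)
                      (isUnitary_toHeckeCharacter L μ) ((isOscillatorChar_toHeckeCharacter_iff μ).mpr hμ)
                      (TW (↥(maximalRealSubfield L)) a) (isSymm_TW (↥(maximalRealSubfield L)) a)
                      (isUnit_det_TW (↥(maximalRealSubfield L)) a) (JW (↥(maximalRealSubfield L)) L a)
                      (JW_eq (↥(maximalRealSubfield L)) L a)) a χ)),
                  f (
                  (rhoAtLine (↥(maximalRealSubfield L)) L (IsCMField.complexConj L) 3 e₁ (Matrix.diagonal dV)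
                    (complexConj_imagUnit L) (imagUnit_ne_zero L) (imagUnit_mul_self L) (realDiagonal_isSymm L dV hdV)
                    (isUnit_det_realDiagonal L dV hdV hdV0) (realDiagonal_map L dV hdV).symm
                    (fun a => isCompatible_chiSplittingLine L e₁ dV hdV hdV0 (toHeckeCharacter L μ)
                      (isUnitary_toHeckeCharacter L μ) ((isOscillatorChar_toHeckeCharacter_iff μ).mpr hμ)
                      (TW (↥(maximalRealSubfield L)) a) (isSymm_TW (↥(maximalRealSubfield L)) a)
                      (isUnit_det_TW (↥(maximalRealSubfield L)) a) (JW (↥(maximalRealSubfield L)) L a)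
                      (JW_eq (↥(maximalRealSubfield L)) L a)) ιV a χ) k x) =
                  (rhoAtLine (↥(maximalRealSubfield L)) L (IsCMField.complexConj L) 3 e₁ (Matrix.diagonal dV)
                    (complexConj_imagUnit L) (imagUnit_ne_zero L) (imagUnit_mul_self L) (realDiagonal_isSymm L dV hdV)
                    (isUnit_det_realDiagonal L dV hdV hdV0) (realDiagonal_map L dV hdV).symm
                    (fun a => isCompatible_chiSplittingLine L e₁ dV hdV hdV0 (toHeckeCharacter L μ)
                      (isUnitary_toHeckeCharacter L μ) ((isOscillatorChar_toHeckeCharacter_iff μ).mpr hμ)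
                      (TW (↥(maximalRealSubfield L)) a) (isSymm_TW (↥(maximalRealSubfield L)) a)
                      (isUnit_det_TW (↥(maximalRealSubfield L)) a) (JW (↥(maximalRealSubfield L)) L a)
                      (JW_eq (↥(maximalRealSubfield L)) L a)) ιV a' χ') k (f x)) →
            locF (↥(maximalRealSubfield L)) (imagUnitSq L) a' = locF (↥(maximalRealSubfield L)) (imagUnitSq L) a := by
  intro L _ _ _ H n' e dV hdV hdV0 g hg ιV hιV μ hμ a χ a' χ' hst
  -- (0) ENUMERATION: transport the global equivalence to `pU := Equiv.prodUnique (Fin 3) (Fin 1)`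
  obtain ⟨f, hf⟩ := hst
  obtain ⟨R⟩ := nonempty_equiv_rhoAtLine_chi_reindex L dV hdV hdV0 μ hμ a χ e (Equiv.prodUnique (Fin 3) (Fin 1)) ιV
  obtain ⟨R'⟩ := nonempty_equiv_rhoAtLine_chi_reindex L dV hdV hdV0 μ hμ a' χ' e (Equiv.prodUnique (Fin 3) (Fin 1)) ιV
  have T := (R.symm.trans (Representation.Equiv.mk f fun k => LinearMap.ext (hf k))).trans R'
  -- (1) RESTRICTION: `ιV` onto, the carrier non-zero, Lem. D.1 (1) per place ⟹ local types equivalent at every `v`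
  have hsurj := surjective_of_pinned L H dV g hg ιV hιV
  have hnt := nontrivial_omegaAtLine_rank3 L (Equiv.prodUnique (Fin 3) (Fin 1)) dV hdV hdV0 μ hμ a χ
  have hloc :
      ∀ v : HeightOneSpectrum (𝓞 ↥(maximalRealSubfield L)),
        LemD1.SameClass
          (S := LemD1OfPlace.standingData L v (IsCMField.complexConj L) 3 (Matrix.diagonal dV) (complexConj_imagUnit L) (imagUnit_ne_zero L)
            (by norm_num)
            (transpose_map_conj_JV (↥(maximalRealSubfield L)) L (IsCMField.complexConj L) 3 (Matrix.diagonal dV)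
              (realDiagonal_isSymm L dV hdV) (realDiagonal_map L dV hdV).symm)
            (det_JV_ne_zero (↥(maximalRealSubfield L)) L 3 (Matrix.diagonal dV) (isUnit_det_realDiagonal L dV hdV hdV0)
              (realDiagonal_map L dV hdV).symm))
          ⟨epsLine L (imagUnit_ne_zero L) a v,
            epsLine_mem_skew L (IsCMField.complexConj L) 3 (Matrix.diagonal dV) (complexConj_imagUnit L) (imagUnit_ne_zero L)
              (by norm_num)
              (transpose_map_conj_JV (↥(maximalRealSubfield L)) L (IsCMField.complexConj L) 3 (Matrix.diagonal dV)
                (realDiagonal_isSymm L dV hdV) (realDiagonal_map L dV hdV).symm)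
              (det_JV_ne_zero (↥(maximalRealSubfield L)) L 3 (Matrix.diagonal dV) (isUnit_det_realDiagonal L dV hdV hdV0)
                (realDiagonal_map L dV hdV).symm) a v⟩
          ⟨epsLine L (imagUnit_ne_zero L) a' v,
            epsLine_mem_skew L (IsCMField.complexConj L) 3 (Matrix.diagonal dV) (complexConj_imagUnit L) (imagUnit_ne_zero L)
              (by norm_num)
              (transpose_map_conj_JV (↥(maximalRealSubfield L)) L (IsCMField.complexConj L) 3 (Matrix.diagonal dV)
                (realDiagonal_isSymm L dV hdV) (realDiagonal_map L dV hdV).symm)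
              (det_JV_ne_zero (↥(maximalRealSubfield L)) L 3 (Matrix.diagonal dV) (isUnit_det_realDiagonal L dV hdV hdV0)
                (realDiagonal_map L dV hdV).symm) a' v⟩ := by
    intro v
    -- the local types `X_v(μ, a, χ)` and `X_v(μ, a', χ')` (enumeration `pU`) are equivalent
    obtain ⟨eqv⟩ := nonempty_equiv_localTypes_of_equiv (↥(maximalRealSubfield L)) L (IsCMField.complexConj L) 3
      (Equiv.prodUnique (Fin 3) (Fin 1)) (Matrix.diagonal dV) (complexConj_imagUnit L) (imagUnit_ne_zero L) (imagUnit_mul_self L)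
      (realDiagonal_isSymm L dV hdV) (isUnit_det_realDiagonal L dV hdV hdV0) (realDiagonal_map L dV hdV).symm
      (fun b => isCompatible_chiSplittingLine L (Equiv.prodUnique (Fin 3) (Fin 1)) dV hdV hdV0 (toHeckeCharacter L μ)
        (isUnitary_toHeckeCharacter L μ) ((isOscillatorChar_toHeckeCharacter_iff μ).mpr hμ) (TW (↥(maximalRealSubfield L)) b)
        (isSymm_TW (↥(maximalRealSubfield L)) b) (isUnit_det_TW (↥(maximalRealSubfield L)) b)
        (JW (↥(maximalRealSubfield L)) L b) (JW_eq (↥(maximalRealSubfield L)) L b))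
      (fun b => isCompatible_chiSplittingLine L (Equiv.prodUnique (Fin 3) (Fin 1)) dV hdV hdV0 (toHeckeCharacter L μ)
        (isUnitary_toHeckeCharacter L μ) ((isOscillatorChar_toHeckeCharacter_iff μ).mpr hμ) (TW (↥(maximalRealSubfield L)) b)
        (isSymm_TW (↥(maximalRealSubfield L)) b) (isUnit_det_TW (↥(maximalRealSubfield L)) b)
        (JW (↥(maximalRealSubfield L)) L b) (JW_eq (↥(maximalRealSubfield L)) L b))
      a χ
      (OmegaChiSplitting.chiLocalSplittingsD ⟨L⟩ (Equiv.prodUnique (Fin 3) (Fin 1)) dV hdV hdV0 (toHeckeCharacter L μ)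
        ((isOscillatorChar_toHeckeCharacter_iff μ).mpr hμ) a)
      a' χ'
      (OmegaChiSplitting.chiLocalSplittingsD ⟨L⟩ (Equiv.prodUnique (Fin 3) (Fin 1)) dV hdV hdV0 (toHeckeCharacter L μ)
        ((isOscillatorChar_toHeckeCharacter_iff μ).mpr hμ) a')
      (OmegaChiSplitting.hfac_sChiD ⟨L⟩ (Equiv.prodUnique (Fin 3) (Fin 1)) dV hdV hdV0 (toHeckeCharacter L μ)
        (isUnitary_toHeckeCharacter L μ) ((isOscillatorChar_toHeckeCharacter_iff μ).mpr hμ) a)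
      (OmegaChiSplitting.hfac_sChiD ⟨L⟩ (Equiv.prodUnique (Fin 3) (Fin 1)) dV hdV hdV0 (toHeckeCharacter L μ)
        (isUnitary_toHeckeCharacter L μ) ((isOscillatorChar_toHeckeCharacter_iff μ).mpr hμ) a')
      (le_refl 3)
      (localMu L (toHeckeCharacter L μ)) (fun v x => norm_localMu L (toHeckeCharacter L μ) v (isUnitary_toHeckeCharacter L μ) x)
      (continuous_localMu L (toHeckeCharacter L μ))
      (fun v t => localMu_toLocalRing_eq_one_iff L (toHeckeCharacter L μ) v ((isOscillatorChar_toHeckeCharacter_iff μ).mpr hμ) t)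
      (localMu L (toHeckeCharacter L μ)) (fun v x => norm_localMu L (toHeckeCharacter L μ) v (isUnitary_toHeckeCharacter L μ) x)
      (continuous_localMu L (toHeckeCharacter L μ))
      (fun v t => localMu_toLocalRing_eq_one_iff L (toHeckeCharacter L μ) v ((isOscillatorChar_toHeckeCharacter_iff μ).mpr hμ) t)
      (fun v => lemD1_1AsPrinted_chi L (Equiv.prodUnique (Fin 3) (Fin 1)) dV hdV hdV0 (le_refl 3) μ hμ a χ v)
      (fun v => lemD1_1AsPrinted_chi L (Equiv.prodUnique (Fin 3) (Fin 1)) dV hdV hdV0 (le_refl 3) μ hμ a' χ' v)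
      hsurj hnt ⟨T.toLinearEquiv, fun k x => by
        rw [Representation.Equiv.toLinearEquiv_apply, Representation.Equiv.toLinearEquiv_apply]
        exact T.toIntertwiningMap.isIntertwining _ _ k x⟩ v
    by_cases hE : IsField (UnitaryGroup.LocalRing L v)
    · -- NON-SPLIT `v`: the ε-clause of Lem. D.1 (3) for the 2-member family `b ↦ (a_b, χ_b)` (`false ↦ (a, χ)`, `true ↦ (a', χ')`) at `pU`
      have h3 := sameClass_and_chi_eq_of_areIsomorphicRep_nonsplit_prodUnique (↥(maximalRealSubfield L)) L (IsCMField.complexConj L)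
        (Matrix.diagonal dV) (complexConj_imagUnit L) (imagUnit_ne_zero L) (imagUnit_mul_self L) rankOne_theta_lines_disjoint_holds
        (realDiagonal_isSymm L dV hdV) (isUnit_det_realDiagonal L dV hdV hdV0) (realDiagonal_map L dV hdV).symm
        (ι := Bool) (fun b => bif b then a' else a) (fun b => bif b then χ' else χ)
        (fun b => OmegaChiSplitting.chiLocalSplittingsD ⟨L⟩ (Equiv.prodUnique (Fin 3) (Fin 1)) dV hdV hdV0 (toHeckeCharacter L μ)
          ((isOscillatorChar_toHeckeCharacter_iff μ).mpr hμ) (bif b then a' else a))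
        (fun _ => localMu L (toHeckeCharacter L μ))
        (fun _ v x => norm_localMu L (toHeckeCharacter L μ) v (isUnitary_toHeckeCharacter L μ) x)
        (fun _ => continuous_localMu L (toHeckeCharacter L μ))
        (fun _ v t => localMu_toLocalRing_eq_one_iff L (toHeckeCharacter L μ) v ((isOscillatorChar_toHeckeCharacter_iff μ).mpr hμ) t)
        v hE false true
        (areIsomorphicRep_of_equiv
          (((quotEquivLocalType (↥(maximalRealSubfield L)) L (IsCMField.complexConj L) 3 (Equiv.prodUnique (Fin 3) (Fin 1))
                (Matrix.diagonal dV) (complexConj_imagUnit L) (imagUnit_ne_zero L) (imagUnit_mul_self L) (realDiagonal_isSymm L dV hdV)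
                (isUnit_det_realDiagonal L dV hdV hdV0) (realDiagonal_map L dV hdV).symm a'
                (OmegaChiSplitting.chiLocalSplittingsD ⟨L⟩ (Equiv.prodUnique (Fin 3) (Fin 1)) dV hdV hdV0 (toHeckeCharacter L μ)
                  ((isOscillatorChar_toHeckeCharacter_iff μ).mpr hμ) a')
                (le_refl 3) (localMu L (toHeckeCharacter L μ))
                (fun v x => norm_localMu L (toHeckeCharacter L μ) v (isUnitary_toHeckeCharacter L μ) x)
                (continuous_localMu L (toHeckeCharacter L μ))
                (fun v t => localMu_toLocalRing_eq_one_iff L (toHeckeCharacter L μ) v ((isOscillatorChar_toHeckeCharacter_iff μ).mpr hμ) t)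
                χ' v).trans
              (Representation.Equiv.mk eqv.symm.toLinearEquiv fun u => by
                rw [Representation.Equiv.toLinearEquiv_toLinearMap]
                exact eqv.symm.isIntertwining' _)).trans
            (quotEquivLocalType (↥(maximalRealSubfield L)) L (IsCMField.complexConj L) 3 (Equiv.prodUnique (Fin 3) (Fin 1))
                (Matrix.diagonal dV) (complexConj_imagUnit L) (imagUnit_ne_zero L) (imagUnit_mul_self L) (realDiagonal_isSymm L dV hdV)
                (isUnit_det_realDiagonal L dV hdV hdV0) (realDiagonal_map L dV hdV).symm a
                (OmegaChiSplitting.chiLocalSplittingsD ⟨L⟩ (Equiv.prodUnique (Fin 3) (Fin 1)) dV hdV hdV0 (toHeckeCharacter L μ)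
                  ((isOscillatorChar_toHeckeCharacter_iff μ).mpr hμ) a)
                (le_refl 3) (localMu L (toHeckeCharacter L μ))
                (fun v x => norm_localMu L (toHeckeCharacter L μ) v (isUnitary_toHeckeCharacter L μ) x)
                (continuous_localMu L (toHeckeCharacter L μ))
                (fun v t => localMu_toLocalRing_eq_one_iff L (toHeckeCharacter L μ) v ((isOscillatorChar_toHeckeCharacter_iff μ).mpr hμ) t)
                χ v).symm))
      exact h3.1
    · -- SPLIT `v`: one ε-class
      obtain ⟨w, hw⟩ := SplitPlace.exists_placesOver_smul_ne_of_not_isField L v (IsCMField.complexConj L)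
        (UnitaryGroup.algEquiv_ne_one_of_apply_eq_neg (↥(maximalRealSubfield L)) L (IsCMField.complexConj L)
          (complexConj_imagUnit L) (imagUnit_ne_zero L)) hE
      exact LemD1IndexedNonVacuityNonsplitPlace.sameClass_of_split L v (IsCMField.complexConj L) (complexConj_imagUnit L)
        (imagUnit_ne_zero L) 3 (Matrix.diagonal dV) _ _ _ w hw _ _
  -- (3) GLOBALISATION
  exact (locF_eq_of_forall_sameClass_epsLine (↥(maximalRealSubfield L)) L (IsCMField.complexConj L) 3 (Matrix.diagonal dV)
    (complexConj_imagUnit L) (imagUnit_ne_zero L) (imagUnit_mul_self L) _ _ _ a a' hloc).symm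

end Summit.HodgeConjecture.HodgeConjecture.Cruxes.H413.F0P2mStubRIGeps

end
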